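import Summits.CriticalPhenomena.CardyFormulaZ2.Theorems.CardyMagicRigidityNestingRigidityTomographyDictionary
import Summits.CriticalPhenomena.CardyFormulaZ2.Theorems.CardyMagicRigidityNestingRigidityNeckCoarseZ2Locality
import Literature.Probability.Percolation.BoxCrossingUpperBound
import HarnessLib

/-!
# The dictionary of neck tomography on `ℤ²`: glued primal/dual partitions are clusters off the collars

Crux `Summit.CriticalPhenomena.CardyFormulaZ2.Theses.CardyMagicRigidity.NestingRigidity` (stmt-CriticalPhenomena-4835),
line `pinch-resampling` v4, stub S10' `stub_neckTomographyV4`.  The `ℤ²` twin (typing note `S10p-typing-v2.md`, A4: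
"ℤ² twins provable the same way") of the dictionary `tGlue_iff_reachable` of `…NestingRigidityTomographyDictionary`
(p160765), obtained by ABSTRACTING that proof:

* §1 `Glue.rel` — the glued relation of an arbitrary "colour graph" `H ≤ G` on a vertex type `V`, for a family of
  regions indexed by `ι` (selected set `Sel`, interiors `I x ⊆` big regions `O x`) and a state vector `b : ι → Bool`
  read in colour `c`: the equivalence closure of "joined by an `H`-path avoiding all selected interiors" (blob step) or
  "both are crossings of the annulus `O x ∖ I x` of a selected `x` with `b x = c`" (passage).  **`Glue.rel_iff_reachable`**:
  if `G`-neighbours of interiors stay in the big regions, the big regions of distinct selected indices are disjoint,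
  every selected annulus has exactly two `H`-crossing clusters (`TwoCrossingClusters`) and `b x = c ↔ HookedUp`, then
  two vertices off all big regions are glued iff they are `H`-reachable (path-following invariant `Glue.inv`, verbatim
  the argument of `tGlue_inv_of_reflTransGen`).
* §2 `ℤ²` (bond): `zGlueP sc X ω b` and `zGlueD sc X ω b` ARE `Glue.rel` for (`zdGraph 2`, `openGraph ω`, primal
  boxes, `c = true`) resp. (`zdGraph 2`, `openGraph (dualConfig ω)`, dual boxes, `c = false`) — `rfl`; the box
  geometry (`mem_zBall_succ_of_adj`, its dual-box twin `mem_zDualBall_two_mul_of_adj`); registered anchor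
  **`zGlueP_iff_reachable`** (general `b`, lattice configurations `ω ⊆ E(ℤ²)`, pairwise disjoint primal closed collars)
  and `zGlueD_iff_reachable`; the PRIMAL dictionary for the realised states is unconditional
  (`zGlueP_zState_iff_reachable`: `zState x = true ↔ ZHookR` by definition), the DUAL one is displayed-conditional on
  the `ℤ²` disc duality "not primal-hooked ↔ dual-hooked under `ZFourStrands`" (`zGlueD_zState_iff_reachable`), the
  `ℤ²` analogue of `tDiscDuality_holds` (not proved here).

Sorry-free; no `Prop` definition is introduced or used as a hypothesis.
-/

noncomputable section

namespace Summit.CriticalPhenomena.CardyFormulaZ2.Cruxes.NestingRigidity.PinchResampling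

open Summit.CriticalPhenomena.CardyFormulaZ2.Theses.CardyMagicRigidity
open Set Relation Literature.Probability.Percolation Literature.Probability.LatticeModels

/-! ## §1 The abstract glued relation and its dictionary -/

namespace Glue

variable {V ι : Type*} (G H : SimpleGraph V) (Sel : Set ι) (I O : ι → Set V) (c : Bool) (b : ι → Bool)

/-- **The glued relation**: equivalence closure of "blob step" (an `H`-path avoiding all selected interiors) or
"passage" (both are `H`-crossings of the annulus of a selected `x` whose state reads `c`). -/
def rel : Setoid V :=
  EqvGen.setoid fun v w ↦ PathIn H (⋃ x ∈ Sel, I x)ᶜ v w ∨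
    ∃ x ∈ Sel, b x = c ∧ IsCrossing G H (I x) (O x) v ∧ IsCrossing G H (I x) (O x) w

variable {G H Sel I O c b}

/-- Unfolding the glued relation. -/
theorem rel_apply_iff (v w : V) : rel G H Sel I O c b v w ↔ EqvGen (fun v w ↦ PathIn H (⋃ x ∈ Sel, I x)ᶜ v w ∨
    ∃ x ∈ Sel, b x = c ∧ IsCrossing G H (I x) (O x) v ∧ IsCrossing G H (I x) (O x) w) v w :=
  Iff.rfl

/-- A blob step glues. -/
theorem rel_of_pathIn {v w : V} (h : PathIn H (⋃ x ∈ Sel, I x)ᶜ v w) : rel G H Sel I O c b v w :=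
  EqvGen.rel _ _ (Or.inl h)

/-- A passage glues. -/
theorem rel_of_passage {x : ι} {v w : V} (hx : x ∈ Sel) (hb : b x = c) (hv : IsCrossing G H (I x) (O x) v)
    (hw : IsCrossing G H (I x) (O x) w) : rel G H Sel I O c b v w :=
  EqvGen.rel _ _ (Or.inr ⟨x, hx, hb, hv, hw⟩)

/-- **Glued ⟹ reachable**, as soon as every passage region is hooked up. -/
theorem reachable_of_rel (hhook : ∀ x ∈ Sel, b x = c → HookedUp G H (I x) (O x)) {v w : V}
    (h : rel G H Sel I O c b v w) : H.Reachable v w := by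
  rw [rel_apply_iff] at h
  induction h with
  | rel v w hr =>
    rcases hr with hp | ⟨x, hx, hb, hv, hw⟩
    · exact Tomography.reachable_of_pathIn hp
    · exact Tomography.reachable_of_pathIn (hhook x hx hb v w hv hw)
  | refl => rfl
  | symm _ _ _ ih => exact ih.symm
  | trans _ _ _ _ _ ih1 ih2 => exact ih1.trans ih2

section Geometry

variable (hIO : ∀ x ∈ Sel, I x ⊆ O x) (hdisj : ∀ x ∈ Sel, ∀ y ∈ Sel, x ≠ y → Disjoint (O x) (O y))
include hIO hdisj

/-- With disjoint big regions, a vertex of the annulus of a selected `x` is off all selected interiors. -/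
theorem not_mem_interiors {x : ι} {u : V} (hx : x ∈ Sel) (hu : u ∈ O x) (huI : u ∉ I x) : u ∉ ⋃ y ∈ Sel, I y := by
  simp only [mem_iUnion, not_exists]
  intro y hy huy
  by_cases hxy : x = y
  · subst hxy; exact huI huy
  · exact Set.disjoint_left.1 (hdisj x hx y hy hxy) hu (hIO y hy huy)

/-- Hence a path inside a selected annulus is a blob step. -/
theorem rel_of_pathIn_annulus {x : ι} {u v : V} (hx : x ∈ Sel) (h : PathIn H (O x \ I x) u v) :
    rel G H Sel I O c b u v :=
  rel_of_pathIn (h.mono fun _ hz ↦ not_mem_interiors hIO hdisj hx hz.1 hz.2)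

end Geometry

/-- **Exit step** (cf. `tGlue_exit`): a vertex `u` of the annulus of the selected `y` carrying the annulus invariant,
stepping to an `H`-neighbour `u'` outside `O y` and off the interiors, yields `u'` glued to the start. -/
theorem exit (hHG : H ≤ G) (hIO : ∀ x ∈ Sel, I x ⊆ O x)
    (hdisj : ∀ x ∈ Sel, ∀ y ∈ Sel, x ≠ y → Disjoint (O x) (O y))
    (h2 : ∀ x ∈ Sel, TwoCrossingClusters G H (I x) (O x))
    (hhook : ∀ x ∈ Sel, HookedUp G H (I x) (O x) → b x = c)
    {v u u' : V} {y : ι} (hy : y ∈ Sel) (hu : u ∈ O y) (huI : u ∉ I y)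
    (hB : (∃ g, rel G H Sel I O c b v g ∧ PathIn H (O y \ I y) g u ∧ (g ∈ outerLayer G (I y) (O y) ∨ IsCrossing G H (I y) (O y) g)) ∨
      (∃ a g', IsCrossing G H (I y) (O y) a ∧ rel G H Sel I O c b v a ∧ g' ∈ innerLayer G (I y) (O y) ∧
        PathIn H (O y) a g' ∧ PathIn H (O y \ I y) g' u))
    (hadj : H.Adj u u') (hu' : u' ∉ O y) (hu'S : u' ∉ ⋃ x ∈ Sel, I x) : rel G H Sel I O c b v u' := by
  have hvu : rel G H Sel I O c b v u := by
    rcases hB with ⟨g, hvg, hgu, -⟩ | ⟨a, g', ha, hva, hg'in, hag', hg'u⟩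
    · exact (rel G H Sel I O c b).trans' hvg (rel_of_pathIn_annulus hIO hdisj hy hgu)
    · have huout : u ∈ outerLayer G (I y) (O y) := ⟨⟨hu, huI⟩, u', hu', hHG hadj⟩
      have hg' : IsCrossing G H (I y) (O y) g' := ⟨hg'in, u, huout, hg'u⟩
      have hag : rel G H Sel I O c b a g' := by
        by_cases hp : PathIn H (O y \ I y) a g'
        · exact rel_of_pathIn_annulus hIO hdisj hy hp
        · exact rel_of_passage hy (hhook y hy (hookedUp_of_pathIn_of_not_pathIn (h2 y hy) ha hg' hp hag')) ha hg'
      exact (rel G H Sel I O c b).trans' ((rel G H Sel I O c b).trans' hva hag) (rel_of_pathIn_annulus hIO hdisj hy hg'u)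
  exact (rel G H Sel I O c b).trans' hvu (rel_of_pathIn (PathIn.of_adj (not_mem_interiors hIO hdisj hy hu huI) hu'S hadj))

/-- **The path invariant** (cf. `tGlue_inv_of_reflTransGen`): along an `H`-path from a vertex `v` off all big
regions, (A) off the big regions the current vertex is glued to `v`; (B) in the annulus of a selected `x` it is
annulus-joined to a glued outer-layer vertex or crossing, or joined inside `O x`, through an inner-layer vertex, to a
glued crossing; (C) in the interior of `x` it is joined inside `O x` to a glued crossing. -/
theorem inv (hHG : H ≤ G) (hIO : ∀ x ∈ Sel, I x ⊆ O x)
    (hnb : ∀ x ∈ Sel, ∀ u ∈ I x, ∀ u', G.Adj u u' → u' ∈ O x)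
    (hdisj : ∀ x ∈ Sel, ∀ y ∈ Sel, x ≠ y → Disjoint (O x) (O y))
    (h2 : ∀ x ∈ Sel, TwoCrossingClusters G H (I x) (O x))
    (hhook : ∀ x ∈ Sel, HookedUp G H (I x) (O x) → b x = c)
    {v : V} (hv : v ∉ ⋃ x ∈ Sel, O x) {u : V} (h : ReflTransGen H.Adj v u) :
    (u ∉ ⋃ x ∈ Sel, O x → rel G H Sel I O c b v u) ∧
    (∀ x ∈ Sel, u ∈ O x → u ∉ I x →
      (∃ g, rel G H Sel I O c b v g ∧ PathIn H (O x \ I x) g u ∧ (g ∈ outerLayer G (I x) (O x) ∨ IsCrossing G H (I x) (O x) g)) ∨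
      (∃ a g', IsCrossing G H (I x) (O x) a ∧ rel G H Sel I O c b v a ∧ g' ∈ innerLayer G (I x) (O x) ∧
        PathIn H (O x) a g' ∧ PathIn H (O x \ I x) g' u)) ∧
    (∀ x ∈ Sel, u ∈ I x → ∃ a, IsCrossing G H (I x) (O x) a ∧ rel G H Sel I O c b v a ∧ PathIn H (O x) a u) := by
  have hoff : ∀ {w : V}, w ∉ ⋃ x ∈ Sel, O x → ∀ x ∈ Sel, w ∉ O x := fun hw x hx h' ↦ hw (mem_biUnion hx h')
  have hS : (⋃ x ∈ Sel, I x) ⊆ ⋃ x ∈ Sel, O x := iUnion₂_mono fun x hx ↦ hIO x hx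
  induction h with
  | refl =>
    refine ⟨fun _ ↦ (rel G H Sel I O c b).refl' v, fun x hx hvO _ ↦ absurd hvO (hoff hv x hx), fun x hx hvI ↦ ?_⟩
    exact absurd (hIO x hx hvI) (hoff hv x hx)
  | @tail u u' _ hadj ih =>
    obtain ⟨hA, hB, hC⟩ := ih
    have hadjG : G.Adj u u' := hHG hadj
    have hglue : u' ∉ (⋃ x ∈ Sel, I x) → (∀ y ∈ Sel, u ∈ O y → u' ∉ O y) → rel G H Sel I O c b v u' := by
      intro hu'S hout
      by_cases huC : u ∈ ⋃ x ∈ Sel, O x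
      · have huC' := huC
        simp only [mem_iUnion] at huC'
        obtain ⟨y, hy, huy⟩ := huC'
        by_cases huI : u ∈ I y
        · exact absurd (hnb y hy u huI u' hadjG) (hout y hy huy)
        · exact exit hHG hIO hdisj h2 hhook hy huy huI (hB y hy huy huI) hadj (hout y hy huy) hu'S
      · exact (rel G H Sel I O c b).trans' (hA huC) (rel_of_pathIn (PathIn.of_adj (fun h ↦ huC (hS h)) hu'S hadj))
    refine ⟨fun hu'C ↦ ?_, fun x hx hu'O hu'I ↦ ?_, fun x hx hu'I ↦ ?_⟩
    · exact hglue (fun h ↦ hu'C (hS h)) fun y hy _ ↦ hoff hu'C y hy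
    · by_cases hux : u ∈ O x
      · by_cases huI : u ∈ I x
        · obtain ⟨a, ha, hva, hau⟩ := hC x hx huI
          exact Or.inr ⟨a, u', ha, hva, ⟨⟨hu'O, hu'I⟩, u, huI, hadjG.symm⟩, hau.tail hadj hu'O, PathIn.refl ⟨hu'O, hu'I⟩⟩
        · rcases hB x hx hux huI with ⟨g, hvg, hgu, hg⟩ | ⟨a, g', ha, hva, hg'in, hag', hg'u⟩
          · exact Or.inl ⟨g, hvg, hgu.tail hadj ⟨hu'O, hu'I⟩, hg⟩
          · exact Or.inr ⟨a, g', ha, hva, hg'in, hag', hg'u.tail hadj ⟨hu'O, hu'I⟩⟩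
      · have hout : u' ∈ outerLayer G (I x) (O x) := ⟨⟨hu'O, hu'I⟩, u, hux, hadjG.symm⟩
        have hvu' : rel G H Sel I O c b v u' := by
          refine hglue (not_mem_interiors hIO hdisj hx hu'O hu'I) fun y hy huy ↦ ?_
          have hxy : x ≠ y := fun h ↦ hux (h ▸ huy)
          exact Set.disjoint_left.1 (hdisj x hx y hy hxy) hu'O
        exact Or.inl ⟨u', hvu', PathIn.refl ⟨hu'O, hu'I⟩, Or.inl hout⟩
    · have hu'O : u' ∈ O x := hIO x hx hu'I
      by_cases hux : u ∈ O x
      · by_cases huI : u ∈ I x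
        · obtain ⟨a, ha, hva, hau⟩ := hC x hx huI
          exact ⟨a, ha, hva, hau.tail hadj hu'O⟩
        · have huin : u ∈ innerLayer G (I x) (O x) := ⟨⟨hux, huI⟩, u', hu'I, hadjG⟩
          rcases hB x hx hux huI with ⟨g, hvg, hgu, hg⟩ | ⟨a, g', ha, hva, -, hag', hg'u⟩
          · have hgerm : IsCrossing G H (I x) (O x) u := by
              rcases hg with hg | ⟨-, w, hw, hgw⟩
              · exact ⟨huin, g, hg, hgu.symm⟩
              · exact ⟨huin, w, hw, hgu.symm.trans hgw⟩
            exact ⟨u, hgerm, (rel G H Sel I O c b).trans' hvg (rel_of_pathIn_annulus hIO hdisj hx hgu),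
              PathIn.of_adj hux hu'O hadj⟩
          · exact ⟨a, ha, hva, (hag'.trans (hg'u.mono fun _ h ↦ h.1)).tail hadj hu'O⟩
      · exact (hux (hnb x hx u' hu'I u hadjG.symm)).elim

/-- **The abstract dictionary.**  Under the standing geometric hypotheses, if the state vector records the colour-`c`
hook-up at every selected region (`b x = c ↔ HookedUp`), two vertices off all big regions are glued iff they are
`H`-reachable. -/
theorem rel_iff_reachable (hHG : H ≤ G) (hIO : ∀ x ∈ Sel, I x ⊆ O x)
    (hnb : ∀ x ∈ Sel, ∀ u ∈ I x, ∀ u', G.Adj u u' → u' ∈ O x)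
    (hdisj : ∀ x ∈ Sel, ∀ y ∈ Sel, x ≠ y → Disjoint (O x) (O y))
    (h2 : ∀ x ∈ Sel, TwoCrossingClusters G H (I x) (O x))
    (hhook : ∀ x ∈ Sel, (b x = c ↔ HookedUp G H (I x) (O x)))
    {v w : V} (hv : v ∉ ⋃ x ∈ Sel, O x) (hw : w ∉ ⋃ x ∈ Sel, O x) :
    rel G H Sel I O c b v w ↔ H.Reachable v w :=
  ⟨reachable_of_rel fun x hx hb ↦ (hhook x hx).1 hb, fun h ↦
    (inv hHG hIO hnb hdisj h2 (fun x hx hH ↦ (hhook x hx).2 hH) hv ((SimpleGraph.reachable_iff_reflTransGen v w).1 h)).1 hw⟩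

end Glue

/-! ## §2 Bond percolation on `ℤ²`: the primal and dual dictionaries -/

section BondZ2

variable {sc : Site 2 → ℕ} {X : Set (Site 2)}

/-- `zGlueP` is the abstract glued relation of the primal open graph with primal boxes, colour `true`. -/
theorem zGlueP_eq_rel (ω : BondConfig (Site 2)) (b : Site 2 → Bool) :
    zGlueP sc X ω b = Glue.rel (zdGraph 2) (openGraph ω) (zSel sc X ω) (fun x ↦ zBall x (sc x))
      (fun x ↦ zBall x (2 * sc x)) true b := rfl

/-- `zGlueD` is the abstract glued relation of the dual open graph with dual boxes, colour `false`. -/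
theorem zGlueD_eq_rel (ω : BondConfig (Site 2)) (b : Site 2 → Bool) :
    zGlueD sc X ω b = Glue.rel (zdGraph 2) (openGraph (dualConfig ω)) (zSel sc X ω) (fun x ↦ zDualBall x (sc x))
      (fun x ↦ zDualBall x (2 * sc x)) false b := rfl

/-- The open graph of a lattice configuration is a subgraph of the lattice. -/
theorem openGraph_le_zdGraph {ω : BondConfig (Site 2)} (hω : ω ⊆ (zdGraph 2).edgeSet) : openGraph ω ≤ zdGraph 2 := by
  intro a b hab
  rw [openGraph_adj] at hab
  exact (SimpleGraph.mem_edgeSet _).1 (hω hab.1)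

/-- An annulus with exactly two crossing clusters is nonempty. -/
theorem nonempty_of_twoCrossingClusters {V : Type*} {G H : SimpleGraph V} {I O : Set V}
    (h : TwoCrossingClusters G H I O) : (O \ I).Nonempty := by
  obtain ⟨⟨v, -, hv, -, -⟩, -⟩ := h
  exact ⟨v, hv.1.1⟩

/-- A selected centre on `ℤ²` has radius `≥ 1` (the primal collar of radius `0` is empty). -/
theorem one_le_of_mem_zSel {ω : BondConfig (Site 2)} {x : Site 2} (hx : x ∈ zSel sc X ω) : 1 ≤ sc x := by
  by_contra h
  have h0 : sc x = 0 := by omega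
  obtain ⟨v, hv⟩ := nonempty_of_twoCrossingClusters hx.2.1
  rw [h0, mul_zero] at hv
  exact hv.2 hv.1

/-- Primal boxes grow: `Λ_s(x) ⊆ Λ_{2s}(x)`. -/
theorem zBall_subset_zBall_two_mul (x : Site 2) (s : ℕ) : zBall x s ⊆ zBall x (2 * s) := by
  intro v hv
  rw [mem_zBall_iff] at hv ⊢
  constructor <;> [have := hv.1; have := hv.2] <;> push_cast <;> omega

/-- A lattice neighbour of a point of `Λ_s(x)` lies in `Λ_{2s}(x)` (`s ≥ 1`). -/
theorem mem_zBall_two_mul_of_adj {x v w : Site 2} {s : ℕ} (hs : 1 ≤ s) (hv : v ∈ zBall x s) (h : (zdGraph 2).Adj v w) :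
    w ∈ zBall x (2 * s) := by
  have hw := NeckCoarseZ2.mem_zBall_succ_of_adj hv h
  rw [mem_zBall_iff] at hw ⊢
  constructor <;> [have := hw.1; have := hw.2] <;> push_cast at this ⊢ <;> omega

/-- Dual boxes grow: the dual box of radius `s + ½` lies in that of radius `2s + ½`. -/
theorem zDualBall_subset_zDualBall_two_mul (x : Site 2) (s : ℕ) : zDualBall x s ⊆ zDualBall x (2 * s) := by
  intro v hv
  rw [mem_zDualBall_iff] at hv ⊢
  constructor <;> [have := hv.1; have := hv.2] <;> push_cast at this ⊢ <;> rw [abs_le] at this ⊢ <;> omega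

/-- A lattice neighbour of a dual vertex of the dual box of radius `s + ½` lies in the dual box of radius `2s + ½`
(`s ≥ 1`: one coordinate moves by one, so `|2(w - x) + 1|_∞ ≤ 2s + 3 ≤ 4s + 1`). -/
theorem mem_zDualBall_two_mul_of_adj {x v w : Site 2} {s : ℕ} (hs : 1 ≤ s) (hv : v ∈ zDualBall x s)
    (h : (zdGraph 2).Adj v w) : w ∈ zDualBall x (2 * s) := by
  rw [mem_zDualBall_iff] at hv ⊢
  rw [Literature.Probability.Percolation.zdGraph_two_adj_iff] at h
  obtain ⟨h1, h2⟩ := hv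
  push_cast at h1 h2 ⊢
  rw [abs_le] at h1 h2 ⊢
  rw [abs_le]
  rcases h with ⟨e0, e1⟩ | ⟨e0, e1⟩ | ⟨e1, e0⟩ | ⟨e1, e0⟩ <;> constructor <;> omega

/-- **Registered anchor — the PRIMAL dictionary on `ℤ²`.**  For a lattice configuration `ω ⊆ E(ℤ²)` whose selected
regions have pairwise disjoint primal closed collars `Λ_{2 sc x}(x)`, and a state vector `b` recording at every
selected region the primal hook-up of its collar crossings (`b x = true ↔ HookedUp`), two sites off the primal closed
collars are primal-glued under `b` iff they lie in the same open cluster of `ω`.  (Abstract dictionary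
`Glue.rel_iff_reachable` for the primal open graph; the two primal crossing clusters are the first half of
`ZFourStrands`.)  For the realised states the hypothesis holds by definition (`zGlueP_zState_iff_reachable`). -/
theorem zGlueP_iff_reachable : ∀ {sc : Site 2 → ℕ} {X : Set (Site 2)} {ω : BondConfig (Site 2)} {b : Site 2 → Bool}, ω ⊆ (zdGraph 2).edgeSet → (∀ x ∈ Summit.CriticalPhenomena.CardyFormulaZ2.Cruxes.NestingRigidity.PinchResampling.zSel sc X ω, ∀ y ∈ Summit.CriticalPhenomena.CardyFormulaZ2.Cruxes.NestingRigidity.PinchResampling.zSel sc X ω, x ≠ y → Disjoint (zBall x (2 * sc x)) (zBall y (2 * sc y))) → (∀ x ∈ Summit.CriticalPhenomena.CardyFormulaZ2.Cruxes.NestingRigidity.PinchResampling.zSel sc X ω, (b x = true ↔ HookedUp (zdGraph 2) (openGraph ω) (zBall x (sc x)) (zBall x (2 * sc x)))) → ∀ {v w : Site 2}, v ∉ (⋃ x ∈ Summit.CriticalPhenomena.CardyFormulaZ2.Cruxes.NestingRigidity.PinchResampling.zSel sc X ω, zBall x (2 * sc x)) → w ∉ (⋃ x ∈ Summit.CriticalPhenomena.CardyFormulaZ2.Cruxes.NestingRigidity.PinchResampling.zSel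 sc X ω, zBall x (2 * sc x)) → (Summit.CriticalPhenomena.CardyFormulaZ2.Cruxes.NestingRigidity.PinchResampling.zGlueP sc X ω b v w ↔ (openGraph ω).Reachable v w) := by
  intro sc X ω b hω hdisj hhook v w hv hw
  rw [zGlueP_eq_rel]
  exact Glue.rel_iff_reachable (openGraph_le_zdGraph hω) (fun x _ ↦ zBall_subset_zBall_two_mul x (sc x))
    (fun x hx u hu u' h ↦ mem_zBall_two_mul_of_adj (one_le_of_mem_zSel hx) hu h) hdisj (fun x hx ↦ hx.2.1) hhook hv hw

/-- **The primal dictionary for the realised states on `ℤ²` (unconditional).** -/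
theorem zGlueP_zState_iff_reachable {ω : BondConfig (Site 2)} (hω : ω ⊆ (zdGraph 2).edgeSet)
    (hdisj : ∀ x ∈ zSel sc X ω, ∀ y ∈ zSel sc X ω, x ≠ y → Disjoint (zBall x (2 * sc x)) (zBall y (2 * sc y)))
    {v w : Site 2} (hv : v ∉ ⋃ x ∈ zSel sc X ω, zBall x (2 * sc x)) (hw : w ∉ ⋃ x ∈ zSel sc X ω, zBall x (2 * sc x)) :
    zGlueP sc X ω (zState sc X ω) v w ↔ (openGraph ω).Reachable v w :=
  zGlueP_iff_reachable hω hdisj (fun x hx ↦ by simp [zState, hx, ZHookR]) hv hw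

/-- **The DUAL dictionary on `ℤ²`.**  With pairwise disjoint DUAL closed collars (dual boxes of radius `2 sc x + ½`)
and a state vector recording at every selected region the dual hook-up as `b x = false`, two dual sites off the dual
closed collars are dual-glued iff they lie in the same dual-open cluster.  (`dualConfig ω ⊆ E(ℤ²)` always, `dualConfig_subset_edgeSet`.) -/
theorem zGlueD_iff_reachable {ω : BondConfig (Site 2)} {b : Site 2 → Bool}
    (hdisj : ∀ x ∈ zSel sc X ω, ∀ y ∈ zSel sc X ω, x ≠ y → Disjoint (zDualBall x (2 * sc x)) (zDualBall y (2 * sc y)))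
    (hhook : ∀ x ∈ zSel sc X ω, (b x = false ↔
      HookedUp (zdGraph 2) (openGraph (dualConfig ω)) (zDualBall x (sc x)) (zDualBall x (2 * sc x))))
    {v w : Site 2} (hv : v ∉ ⋃ x ∈ zSel sc X ω, zDualBall x (2 * sc x)) (hw : w ∉ ⋃ x ∈ zSel sc X ω, zDualBall x (2 * sc x)) :
    zGlueD sc X ω b v w ↔ (openGraph (dualConfig ω)).Reachable v w := by
  rw [zGlueD_eq_rel]
  exact Glue.rel_iff_reachable (openGraph_le_zdGraph (dualConfig_subset_edgeSet ω))
    (fun x _ ↦ zDualBall_subset_zDualBall_two_mul x (sc x))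
    (fun x hx u hu u' h ↦ mem_zDualBall_two_mul_of_adj (one_le_of_mem_zSel hx) hu h) hdisj (fun x hx ↦ hx.2.2) hhook hv hw

/-- **The dual dictionary for the realised states, displayed-conditional on `ℤ²` disc duality** ("not primal-hooked
↔ dual-hooked" at every selected region — the `ℤ²` analogue of `tDiscDuality_holds`, not proved here). -/
theorem zGlueD_zState_iff_reachable {ω : BondConfig (Site 2)}
    (hdisj : ∀ x ∈ zSel sc X ω, ∀ y ∈ zSel sc X ω, x ≠ y → Disjoint (zDualBall x (2 * sc x)) (zDualBall y (2 * sc y)))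
    (hdual : ∀ x ∈ zSel sc X ω, (ω ∉ ZHookR x (sc x) ↔
      HookedUp (zdGraph 2) (openGraph (dualConfig ω)) (zDualBall x (sc x)) (zDualBall x (2 * sc x))))
    {v w : Site 2} (hv : v ∉ ⋃ x ∈ zSel sc X ω, zDualBall x (2 * sc x)) (hw : w ∉ ⋃ x ∈ zSel sc X ω, zDualBall x (2 * sc x)) :
    zGlueD sc X ω (zState sc X ω) v w ↔ (openGraph (dualConfig ω)).Reachable v w :=
  zGlueD_iff_reachable hdisj (fun x hx ↦ by simpa [zState, hx] using hdual x hx) hv hw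

end BondZ2

end Summit.CriticalPhenomena.CardyFormulaZ2.Cruxes.NestingRigidity.PinchResampling

end
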